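import Summits.QuantumFields.BalabanUV.Beta.FP.TorusGaugeCovarianceCoarse
import Summits.QuantumFields.BalabanUV.Beta.FP.TorusCombRows
import Summits.QuantumFields.BalabanUV.Beta.FP.RelInvPeriodised
import Summits.QuantumFields.BalabanUV.Beta.ValueHessianGauge
import Summits.QuantumFields.BalabanUV.Beta.BorderedHessianKernelAction
import Summits.QuantumFields.BalabanUV.Beta.BorderedHessianSymmetry

/-!
# `BalabanUV.Beta.FP.PeriodisedWardOrderZero` — road «FP» for binder row D1, ROUTE T row **(T-ID)**, THE ORDER-0 WARD ROWS AT THE TORUS: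
# **the torus call's `a0` and `a0t` HOLD WITH `Y₀ = Y'₀ := 0` AT EVERY LEVEL `j`** — the periodised field block
# `H₀ := perF (fine Lc M′) (bhKStepAt d (toSite r) Lc j)∘(fields, fields)` KILLS EVERY TORUS GAUGE MODE: `H₀ * D₁ = 0` (fine residual modes),
# `H₀ * D₂ = 0` (block-constant modes), hence `H₀ * fromCols D₂ D₁ = 0 (= 𝔔₀ᵀ * 0)`; and `H₀ᵀ = H₀`, hence `a0t`

HONEST DEPENDENCY (page 1, mandatory): continuum YM on T⁴ ⇐ BetaPertH ∧ nine spine estimates (0/9 proved); BetaPertH ⇐ (D1) ∧ (D4) ∧ CAP+tail;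
G-an2-4 gates asym, D1 and NE2/3/4.  HONEST FRAMING (cell contract, verbatim): «discharging `BetaPertH` makes Bałaban's UV stability UNCONDITIONAL —
a real constructive-QFT result; it is NOT the continuum limit and NOT the Clay problem.»  ABSOLUTE RULE (cell charter, verbatim): «No internally-minted
statement may enter as a cited fact. Every hypothesis is either kernel-proved in this package or a verbatim quotation of a PUBLISHED theorem with page
reference. The manuscript(s) under audit are NOT citable for their own disputed steps — they are the thing under adjudication; programme-internal
(2001/route/tribunal) claims are never citable.»  THIS MODULE is [folklore] summation by parts on `ℤ^{d+1}` and re-indexing of period sums over OUR typed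
objects, fed BY NAME by an2's action lemma for the windowed `d*d` (`BorderedHessian.tsum_bhK_inl_inl`) + the lead's `AffineAveraging.curv_dz` (`j = 0`), an2's
co-closedness of the multiplier response (`ValueHessianBlind.codiff₁_wΦ_right`, `E2_inl_inl_eq_wΦ`; `j ≥ 1`), `spr_bhKStepAt` (decay ⇒ summable rows),
`RelInvPeriodised.bhKStepAt_translate_invariant` + `KernelPeriodisationFib.perF_transpose` + `curvAdj_curv_delta1_symm` ∕ `GAN24.TransverseDictionary.wΦ_symm`
(symmetry), gan24-leaf-05's `tgrad`∕`tdelta`∕`tgradBlock`; no `def`, no `def … : Prop`, nothing cited, 0 sorry; 0 estimates; 0∕4 row-D1 binders; NOT (T-ID)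
complete (the order-1∕2 Ward rows `a1 a2 (+ᵀ)`, the insertion rows `c2 d1 d2`, the jets are the dictionary's), NOT SDF, NOT D1, NOT BetaPertH, NOT continuum,
NOT Clay.  «not in print; our bookkeeping».

WHY.  The OWNER d1-p3's torus call `FP/NestedStepLawTorusInstance.secondVar_oneShot_nestedStepLaw_torus` (p313662; δ-constrained form `…Delta`, INTENT I-FP-17-10)
DISPLAYS, among the second-order composite Ward TABLE IDENTITIES, the ORDER-0 rows `a0 : H₀ * fromCols D₂ D₁ = 𝔔₀ᵀ * Y₀` and `a0t : H₀ᵀ * fromCols D₂ D₁ = 𝔔₀ᵀ * Y'₀`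
with FREE witnesses `Y₀ Y'₀`.  At the torus objects of record they hold with `Y₀ = Y'₀ := 0` and NO composite input: the level-`j` fine form is gauge invariant under
ALL torus gauge modes — at `j = 0` because its field block is the (windowed) matrix of `d*d` and `d ∘ d = 0`; at `j ≥ 1` because its field block `wVH·E2 = wVH·wΦ(x − y)`
is co-closed in each slot (an1∕an2's (W-LH-E2), `ValueHessianGauge`, there for FINITELY SUPPORTED potentials).  The torus needs the PERIODIC indicator potentials
`tdelta M · s` (bounded, not finitely supported): §1–§2 supply that version.

CONTENT (generic `d`; in-block root `toSite r`, `r ∈ box (d+1) Lc`; every `j`).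
* §1 [folklore] `summable_mul_of_bounded`, **`tsum_sum_mul_grad_eq_zero_of_coclosed`**: summable direction rows `g l`, CO-CLOSED (`Σ_l (g l (z − e_l) − g l z) = 0`
  pointwise), against a BOUNDED potential: `Σ'_z Σ_l g l z · (φ (z + e_l) − φ z) = 0`.
* §2 [folklore] **`sum_tsum_translate_mul_grad_periodic`**: the torus pairing of a periodised summable row with the gradient of an `Mℤ^{d+1}`-PERIODIC bounded
  potential unfolds to the lattice pairing (`KernelPeriodisationFibTrace.tsum_sites_eq_sum_tsum`); `abs_tdelta_le`.
* §3 the step-`j` candidate's field block: `summable_bhKStepAt_row`; **`tsum_bhKAt_ff_mul_grad_eq_zero`** (`j = 0`, EVERY potential); `sum_bhKStepAt_succ_ff_codiff_eq_zero`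
  (`j + 1`, pointwise co-closedness); **`tsum_bhKStepAt_ff_mul_grad_eq_zero`** (every `j`, every bounded potential); **`bhKStepAt_ff_symm`**.
* §4 at the torus: **`sum_perZ_bhKStepAt_ff_mul_grad_periodic`** (any box `M`, any periodic bounded `φ`), **`sum_perZ_bhKStepAt_ff_mul_tgrad`** (fine modes),
  **`sum_perZ_bhKStepAt_ff_mul_tgradBlock`** (block-constant modes on `fine Lc M′`; periodicity `tdelta_quo_congr`).
* §5 in the torus call's presentation (`hH₀ hD₁ hD₂` VERBATIM from p313662 ∕ `…Delta`): `torus_H₀_mul_tgrad` ∕ `torus_H₀_mul_tgradBlock` (any column selection),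
  **`torus_H₀_mul_D₁`**, **`torus_H₀_mul_D₂`**, **`torus_a0 : H₀ * fromCols D₂ D₁ = 0`**, **`torus_H₀_transpose : H₀ᵀ = H₀`**, **`torus_a0t : H₀ᵀ * fromCols D₂ D₁ = 0`**,
  and the letter shapes **`torus_a0_letter`** ∕ **`torus_a0t_letter`** (`= 𝔔₀ᵀ * 0` for ANY `𝔔₀` on any coarse multiplier index — pass `Y₀ := 0`, `Y'₀ := 0`).
TRANSPOSED ROWS: with `torus_H₀_transpose` (`H₀ᵀ = H₀`) the call's `a*t` triple IS the `a*` triple (`Y'ₖ := Yₖ`) as soon as the dictionary's insertion jets are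
symmetric (`H₁ᵀ = H₁`, `H₂ᵀ = H₂`) — leaf-02 g16's `CompositeWardLettersK.compWard_at_of_symm` is the generic word (leaf-05 g26's INFO, journal l.39286).
NOT HERE: the order-1 row `a1 : H₁·[D₂|D₁] + H₀·W₁ = 𝔔₁ᵀY₀ + 𝔔₀ᵀY₁` (with `Y₀ = 0` it reads `H₁·[D₂|D₁] + H₀·W₁ = 𝔔₀ᵀY₁`; its fine part is the Hessian tables' four-point
contact law `GAN24.HessianGaugeLegContact`, on request), any estimate.
Provenance: D1 formalisation swarm LEAF PROVER 02, unit b2b-balaban-beta-d1-formalise-leaf-02 gen 18, 2026-08-22.  No existing file touched.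
-/

noncomputable section

open scoped BigOperators

namespace Summit.QuantumFields.BalabanUV.Beta.FP.PeriodisedWardOrderZero

open Finset
open scoped Matrix
open Literature.MathematicalPhysics.QuantumFieldTheory
open Literature.MathematicalPhysics.QuantumFieldTheory.Balaban1983to89
open Literature.MathematicalPhysics.QuantumFieldTheory.Balaban1983to89.Beta
open B4TorusKernel.MultiPeriod (translate translate_apply)
open B5Prop11Plancherel (fine)
open B6Lemma24Torus (pbox mem_pbox)
open B12Sec2to5 (l1)
open ExpKernelCalculus (MKer Decays summable_exp_shift)
open AffineAveraging (Site box toSite unitVec dz curv curvAdj codiff₁ curv_dz)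
open KernelSpecInstance (wΦ)
open LatticeForm (quo)
open OneStepResolventKernel (Fib)
open BalabanStepJetsSucc (E2 wVH)
open Summit.QuantumFields.BalabanUV.Beta.TameKernelCalculus (Spr)
open Summit.QuantumFields.BalabanUV.Beta.BorderedHessian (bhK bhKAt bhKAt_inl_inl bhKStepAt bhKStepAt_zero bhKStepAt_succ_inl_inl spr_bhKStepAt
  E2_inl_inl_eq_wΦ codiff₁_wΦ_right tsum_bhK_inl_inl bhK_inl_inl_eq curvAdj_curv_delta1_symm fcol)
open Summit.QuantumFields.BalabanUV.Beta.GAN24.TransverseDictionary (wΦ_symm)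
open Summit.QuantumFields.BalabanUV.Beta.FP.KernelPeriodisationFib (Idx perF perF_apply perZ perZ_apply trF perF_transpose)
open Summit.QuantumFields.BalabanUV.Beta.FP.KernelPeriodisationFibTrace (tsum_sites_eq_sum_tsum)
open Summit.QuantumFields.BalabanUV.Beta.FP.TorusGaugeCovariance (tdelta tdelta_apply tdelta_translate tgrad tgrad_inl)
open Summit.QuantumFields.BalabanUV.Beta.FP.TorusGaugeCovarianceCoarse (tgradBlock tgradBlock_inl tdelta_quo_congr)
open Summit.QuantumFields.BalabanUV.Beta.FP.TorusCombRows (Res)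
open Summit.QuantumFields.BalabanUV.Beta.FP.RelInvPeriodised (bhKStepAt_translate_invariant)

variable {d : ℕ}

/-! ## §1 A co-closed, summable 1-form-valued kernel row kills the gradient of every BOUNDED potential on `ℤ^{d+1}` -/

section Lattice

/-- [folklore] a summable function times a bounded one is summable. -/
theorem summable_mul_of_bounded {f φ : Site (d + 1) → ℝ} (hf : Summable f) {B : ℝ} (hφ : ∀ z, |φ z| ≤ B) :
    Summable fun z => f z * φ z := by
  refine Summable.of_norm_bounded (g := fun z => ‖f z‖ * B) (hf.norm.mul_right B) fun z => ?_
  rw [norm_mul, Real.norm_eq_abs, Real.norm_eq_abs]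
  exact mul_le_mul_of_nonneg_left (hφ z) (abs_nonneg _)

/-- [folklore] … also against the shifted potential `z ↦ φ (z + e)`. -/
theorem summable_mul_shift_of_bounded {f φ : Site (d + 1) → ℝ} (hf : Summable f) {B : ℝ} (hφ : ∀ z, |φ z| ≤ B) (e : Site (d + 1)) :
    Summable fun z => f z * φ (z + e) :=
  summable_mul_of_bounded hf (φ := fun z => φ (z + e)) fun z => hφ (z + e)

/-- [folklore] **SUMMATION BY PARTS AGAINST A BOUNDED POTENTIAL**: if each direction-`l` row `g l` is summable, the family is CO-CLOSED
(`Σ_l (g l (z − e_l) − g l z) = 0` at every `z`) and `φ` is bounded, then `Σ'_z Σ_l g l z · (φ (z + e_l) − φ z) = 0`.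
(The finitely-supported-`φ` case is an1∕an2's `ValueHessianGauge.tsum_wΦ_mul_grad_eq_zero`; the torus needs PERIODIC `φ`.) -/
theorem tsum_sum_mul_grad_eq_zero_of_coclosed {g : Fin (d + 1) → Site (d + 1) → ℝ} (hg : ∀ l, Summable (g l))
    {φ : Site (d + 1) → ℝ} {B : ℝ} (hφ : ∀ z, |φ z| ≤ B) (hco : ∀ z, ∑ l, (g l (z - unitVec l) - g l z) = 0) :
    ∑' z, ∑ l, g l z * (φ (z + unitVec l) - φ z) = 0 := by
  have hf : ∀ l, Summable fun z => g l z * φ (z + unitVec l) := fun l => summable_mul_shift_of_bounded (hg l) hφ (unitVec l)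
  have hg' : ∀ l, Summable fun z => g l z * φ z := fun l => summable_mul_of_bounded (hg l) hφ
  have hfg : ∀ l, Summable fun z => g l z * (φ (z + unitVec l) - φ z) := fun l =>
    ((hf l).sub (hg' l)).congr fun z => by ring
  have hgs : ∀ l, Summable fun z => g l (z - unitVec l) := fun l =>
    ((Equiv.subRight (unitVec l)).summable_iff.mpr (hg l)).congr fun z => by simp [Equiv.subRight]
  have hs : ∀ l, Summable fun z => g l (z - unitVec l) * φ z := fun l => summable_mul_of_bounded (hgs l) hφ
  -- shift the first series: `Σ'_z g l z · φ (z + e_l) = Σ'_z g l (z − e_l) · φ z`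
  have hshift : ∀ l, ∑' z, g l z * φ (z + unitVec l) = ∑' z, g l (z - unitVec l) * φ z := fun l => by
    rw [← (Equiv.addRight (unitVec l)).tsum_eq (fun z => g l (z - unitVec l) * φ z)]
    refine tsum_congr fun z => ?_
    simp only [Equiv.coe_addRight, add_sub_cancel_right]
  calc ∑' z, ∑ l, g l z * (φ (z + unitVec l) - φ z)
      = ∑ l, ∑' z, g l z * (φ (z + unitVec l) - φ z) := Summable.tsum_finsetSum fun l _ => hfg l
    _ = ∑ l, ((∑' z, g l (z - unitVec l) * φ z) - ∑' z, g l z * φ z) := by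
        refine Finset.sum_congr rfl fun l _ => ?_
        rw [← hshift l, ← (hf l).tsum_sub (hg' l)]
        exact tsum_congr fun z => by ring
    _ = ∑ l, ∑' z, (g l (z - unitVec l) - g l z) * φ z := by
        refine Finset.sum_congr rfl fun l _ => ?_
        rw [← (hs l).tsum_sub (hg' l)]
        exact tsum_congr fun z => by ring
    _ = ∑' z, ∑ l, (g l (z - unitVec l) - g l z) * φ z :=
        (Summable.tsum_finsetSum fun l _ => ((hs l).sub (hg' l)).congr fun z => by ring).symm
    _ = ∑' z, (∑ l, (g l (z - unitVec l) - g l z)) * φ z := tsum_congr fun z => by rw [Finset.sum_mul]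
    _ = 0 := by simp only [hco, zero_mul, tsum_zero]

end Lattice

/-! ## §2 The torus pairing of a periodised summable row with the gradient of a PERIODIC potential unfolds to the lattice pairing -/

section Torus

variable (M : Fin (d + 1) → ℕ) [∀ μ, NeZero (M μ)]

/-- [folklore] **UNFOLDING THE TORUS PAIRING**: for summable direction rows `k l` and an `Mℤ^{d+1}`-PERIODIC bounded potential `φ`,
`Σ_{y ∈ pbox M} Σ_l (Σ'_m k l (y + M∘m)) · (φ (y + e_l) − φ y) = Σ'_z Σ_l k l z · (φ (z + e_l) − φ z)`. -/
theorem sum_tsum_translate_mul_grad_periodic {k : Fin (d + 1) → Site (d + 1) → ℝ} (hk : ∀ l, Summable (k l))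
    {φ : Site (d + 1) → ℝ} (hper : ∀ x m, φ (translate M x m) = φ x) {B : ℝ} (hφ : ∀ z, |φ z| ≤ B) :
    ∑ y : ↥(pbox M), ∑ l : Fin (d + 1), (∑' m : Site (d + 1), k l (translate M (y : Site (d + 1)) m)) * (φ ((y : Site (d + 1)) + unitVec l) - φ y)
      = ∑' z : Site (d + 1), ∑ l : Fin (d + 1), k l z * (φ (z + unitVec l) - φ z) := by
  set H : Fin (d + 1) → Site (d + 1) → ℝ := fun l z => k l z * (φ (z + unitVec l) - φ z) with hH
  have hHs : ∀ l, Summable (H l) := fun l =>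
    ((summable_mul_shift_of_bounded (hk l) hφ (unitVec l)).sub (summable_mul_of_bounded (hk l) hφ)).congr fun z => by
      simp only [hH]; ring
  have hterm : ∀ (y : ↥(pbox M)) (l : Fin (d + 1)),
      (∑' m : Site (d + 1), k l (translate M (y : Site (d + 1)) m)) * (φ ((y : Site (d + 1)) + unitVec l) - φ y)
        = ∑' m : Site (d + 1), H l (translate M (y : Site (d + 1)) m) := fun y l => by
    rw [← tsum_mul_right]
    refine tsum_congr fun m => ?_
    simp only [hH]
    rw [show translate M (y : Site (d + 1)) m + unitVec l = translate M ((y : Site (d + 1)) + unitVec l) m by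
          funext i; simp only [translate_apply, Pi.add_apply]; ring,
      hper, hper]
  calc ∑ y : ↥(pbox M), ∑ l : Fin (d + 1),
        (∑' m : Site (d + 1), k l (translate M (y : Site (d + 1)) m)) * (φ ((y : Site (d + 1)) + unitVec l) - φ y)
      = ∑ y : ↥(pbox M), ∑ l : Fin (d + 1), ∑' m : Site (d + 1), H l (translate M (y : Site (d + 1)) m) :=
        Finset.sum_congr rfl fun y _ => Finset.sum_congr rfl fun l _ => hterm y l
    _ = ∑ l : Fin (d + 1), ∑ y : ↥(pbox M), ∑' m : Site (d + 1), H l (translate M (y : Site (d + 1)) m) := Finset.sum_comm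
    _ = ∑ l : Fin (d + 1), ∑' z : Site (d + 1), H l z := Finset.sum_congr rfl fun l _ => (tsum_sites_eq_sum_tsum M (hHs l)).symm
    _ = ∑' z : Site (d + 1), ∑ l : Fin (d + 1), H l z := (Summable.tsum_finsetSum fun l _ => hHs l).symm

omit [∀ μ, NeZero (M μ)] in
/-- [folklore] the periodic indicator `tdelta M · s` is bounded by `1`. -/
theorem abs_tdelta_le (x : Site (d + 1)) (s : ↥(pbox M)) : |tdelta M x s| ≤ 1 := by
  rw [tdelta_apply]
  split_ifs <;> simp

end Torus

/-! ## §3 The field block of the step-`j` candidate `bhKStepAt d (toSite r) Lc j`: summable rows; it kills the gradient of every bounded potential;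
it is symmetric -/

section StepKernel

variable {Lc : ℕ} [NeZero Lc] {r : Fin (d + 1) → ℕ}

/-- [folklore] every row of the step-`j` candidate is summable in its second site (exponential decay, `spr_bhKStepAt`). -/
theorem summable_bhKStepAt_row (hr : r ∈ box (d + 1) Lc) (j : ℕ) (x : Site (d + 1)) (a b : Fib d) :
    Summable fun z => bhKStepAt d (toSite r) Lc j x z a b := by
  obtain ⟨C, δ, hδ, hK⟩ := spr_bhKStepAt (d := d) hr j
  refine Summable.of_norm_bounded (g := fun z => C * Real.exp (-δ * l1 (x - z))) ((summable_exp_shift hδ x).mul_left C) fun z => ?_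
  rw [Real.norm_eq_abs]
  exact hK x z a b

/-- [folklore] **`j = 0`: THE WINDOWED `d*d` KILLS EVERY EXACT 1-FORM** — `Σ'_z Σ_l bhKAt d ρ N x z (inl κ) (inl l) · (ψ (z + e_l) − ψ z) = 0` for EVERY potential `ψ`
(an2's action lemma `tsum_bhK_inl_inl` — the row is finitely supported, no summability needed — and `curv_dz`). -/
theorem tsum_bhKAt_ff_mul_grad_eq_zero (ρ : Site (d + 1)) (N : ℕ) (x : Site (d + 1)) (κ : Fin (d + 1)) (ψ : Site (d + 1) → ℝ) :
    ∑' z, ∑ l, bhKAt d ρ N x z (Sum.inl κ) (Sum.inl l) * (ψ (z + unitVec l) - ψ z) = 0 := by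
  -- read the exact 1-form `dz ψ` as the field column of a kernel and apply the action lemma
  set X : MKer (d + 1) (Fib d) := fun y _ a _ => Sum.elim (fun l : Fin (d + 1) => dz ψ l y) (fun _ : Fin (d + 1) => (0 : ℝ)) a with hX
  have h := tsum_bhK_inl_inl N X x x κ (Sum.inl κ)
  have hcol : fcol X x (Sum.inl κ) = dz ψ := by
    funext l y
    simp [fcol, hX]
  rw [hcol, curv_dz] at h
  have h0 : curvAdj (0 : AffineAveraging.Form2 (d + 1) ℝ) κ x = 0 := by simp [curvAdj]
  rw [h0] at h
  simpa only [bhKAt_inl_inl, hX, Sum.elim_inl, dz] using h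

/-- [folklore] **`j + 1`: THE VALUE-HESSIAN FIELD BLOCK IS CO-CLOSED IN ITS SECOND SLOT**, pointwise:
`Σ_l (bhKStepAt (j+1) x (z − e_l) (inl κ) (inl l) − bhKStepAt (j+1) x z (inl κ) (inl l)) = 0` (`= wVH · codiff₁ (wΦ κ · (x − ·)) z`, an2's `codiff₁_wΦ_right`). -/
theorem sum_bhKStepAt_succ_ff_codiff_eq_zero (ρ : Site (d + 1)) (j : ℕ) (x z : Site (d + 1)) (κ : Fin (d + 1)) :
    ∑ l, (bhKStepAt d ρ Lc (j + 1) x (z - unitVec l) (Sum.inl κ) (Sum.inl l) - bhKStepAt d ρ Lc (j + 1) x z (Sum.inl κ) (Sum.inl l)) = 0 := by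
  have h := congrFun (codiff₁_wΦ_right (N := Lc ^ (j + 1)) (d := d) κ x) z
  simp only [codiff₁, Pi.zero_apply] at h
  simp only [bhKStepAt_succ_inl_inl, E2_inl_inl_eq_wΦ, ← mul_sub, ← Finset.mul_sum]
  rw [h, mul_zero]

/-- [folklore] **THE FIELD BLOCK OF THE STEP-`j` CANDIDATE KILLS THE GRADIENT OF EVERY BOUNDED POTENTIAL** (in-block root `toSite r`, every `j`):
`Σ'_z Σ_l bhKStepAt d (toSite r) Lc j x z (inl κ) (inl l) · (φ (z + e_l) − φ z) = 0`. -/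
theorem tsum_bhKStepAt_ff_mul_grad_eq_zero (hr : r ∈ box (d + 1) Lc) :
    ∀ (j : ℕ) (x : Site (d + 1)) (κ : Fin (d + 1)) {φ : Site (d + 1) → ℝ} {B : ℝ}, (∀ z, |φ z| ≤ B) →
      ∑' z, ∑ l, bhKStepAt d (toSite r) Lc j x z (Sum.inl κ) (Sum.inl l) * (φ (z + unitVec l) - φ z) = 0
  | 0, x, κ, φ, _, _ => by
    rw [bhKStepAt_zero]
    exact tsum_bhKAt_ff_mul_grad_eq_zero (toSite r) Lc x κ φ
  | j + 1, x, κ, _, _, hφ =>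
    tsum_sum_mul_grad_eq_zero_of_coclosed (fun l => summable_bhKStepAt_row hr (j + 1) x (Sum.inl κ) (Sum.inl l)) hφ
      fun z => sum_bhKStepAt_succ_ff_codiff_eq_zero (toSite r) j x z κ

/-- [folklore] **THE FIELD BLOCK IS SYMMETRIC** at every level: `bhKStepAt j x y (inl κ) (inl l) = bhKStepAt j y x (inl l) (inl κ)`
(`j = 0`: Green's identity for `d*d`, an2's `curvAdj_curv_delta1_symm`; `j + 1`: the GAN24 swarm's `wΦ_symm`). -/
theorem bhKStepAt_ff_symm (ρ : Site (d + 1)) : ∀ (j : ℕ) (x y : Site (d + 1)) (κ l : Fin (d + 1)),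
    bhKStepAt d ρ Lc j x y (Sum.inl κ) (Sum.inl l) = bhKStepAt d ρ Lc j y x (Sum.inl l) (Sum.inl κ)
  | 0, x, y, κ, l => by
    rw [bhKStepAt_zero, bhKAt_inl_inl, bhKAt_inl_inl, bhK_inl_inl_eq, bhK_inl_inl_eq, curvAdj_curv_delta1_symm]
  | j + 1, x, y, κ, l => by
    rw [bhKStepAt_succ_inl_inl, bhKStepAt_succ_inl_inl, E2_inl_inl_eq_wΦ, E2_inl_inl_eq_wΦ, wΦ_symm, neg_sub]

end StepKernel

/-! ## §4 At the torus: the periodised field block kills every torus gauge mode (fine `tgrad` columns and block-constant `tgradBlock` columns) -/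

section TorusKernel

variable {Lc : ℕ} [NeZero Lc] {r : Fin (d + 1) → ℕ}

/-- [folklore] **PERIODISED, AGAINST ANY PERIODIC BOUNDED POTENTIAL**: for a box `M` and an `Mℤ^{d+1}`-periodic bounded `φ`,
`Σ_{y ∈ pbox M} Σ_l perZ M (bhKStepAt d (toSite r) Lc j) x y (inl κ) (inl l) · (φ (y + e_l) − φ y) = 0`. -/
theorem sum_perZ_bhKStepAt_ff_mul_grad_periodic (M : Fin (d + 1) → ℕ) [∀ μ, NeZero (M μ)] (hr : r ∈ box (d + 1) Lc) (j : ℕ)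
    (x : Site (d + 1)) (κ : Fin (d + 1)) {φ : Site (d + 1) → ℝ} (hper : ∀ z m, φ (translate M z m) = φ z) {B : ℝ} (hφ : ∀ z, |φ z| ≤ B) :
    ∑ y : ↥(pbox M), ∑ l : Fin (d + 1), perZ M (bhKStepAt d (toSite r) Lc j) x (y : Site (d + 1)) (Sum.inl κ) (Sum.inl l)
        * (φ ((y : Site (d + 1)) + unitVec l) - φ y) = 0 := by
  simp only [perZ_apply]
  rw [sum_tsum_translate_mul_grad_periodic M (k := fun l z => bhKStepAt d (toSite r) Lc j x z (Sum.inl κ) (Sum.inl l))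
    (fun l => summable_bhKStepAt_row hr j x (Sum.inl κ) (Sum.inl l)) hper hφ]
  exact tsum_bhKStepAt_ff_mul_grad_eq_zero hr j x κ hφ

/-- [folklore] **THE PERIODISED FIELD BLOCK KILLS THE FINE TORUS GAUGE MODES**: for every box `M` and every column `s`,
`Σ_{y ∈ pbox M} Σ_l perZ M (bhKStepAt d (toSite r) Lc j) x y (inl κ) (inl l) · tgrad M (y, inl l) s = 0`. -/
theorem sum_perZ_bhKStepAt_ff_mul_tgrad (M : Fin (d + 1) → ℕ) [∀ μ, NeZero (M μ)] (hr : r ∈ box (d + 1) Lc) (j : ℕ)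
    (x : Site (d + 1)) (κ : Fin (d + 1)) (s : ↥(pbox M)) :
    ∑ y : ↥(pbox M), ∑ l : Fin (d + 1), perZ M (bhKStepAt d (toSite r) Lc j) x (y : Site (d + 1)) (Sum.inl κ) (Sum.inl l) * tgrad M (y, Sum.inl l) s = 0 := by
  simp only [tgrad_inl]
  exact sum_perZ_bhKStepAt_ff_mul_grad_periodic M hr j x κ (φ := fun z => tdelta M z s) (fun z m => tdelta_translate M z m s)
    (fun z => abs_tdelta_le M z s)

/-- [folklore] **… AND THE BLOCK-CONSTANT TORUS GAUGE MODES**: on the fine box `fine Lc M′`, for every coarse column `t`,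
`Σ_{y} Σ_l perZ (fine Lc M′) (bhKStepAt d (toSite r) Lc j) x y (inl κ) (inl l) · tgradBlock M′ Lc (y, inl l) t = 0`. -/
theorem sum_perZ_bhKStepAt_ff_mul_tgradBlock (M' : Fin (d + 1) → ℕ) [∀ μ, NeZero (M' μ)] (hr : r ∈ box (d + 1) Lc) (j : ℕ)
    (x : Site (d + 1)) (κ : Fin (d + 1)) (t : ↥(pbox M')) :
    ∑ y : ↥(pbox (fine Lc M')), ∑ l : Fin (d + 1),
        perZ (fine Lc M') (bhKStepAt d (toSite r) Lc j) x (y : Site (d + 1)) (Sum.inl κ) (Sum.inl l) * tgradBlock M' Lc (y, Sum.inl l) t = 0 := by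
  simp only [tgradBlock_inl]
  refine sum_perZ_bhKStepAt_ff_mul_grad_periodic (fine Lc M') hr j x κ (φ := fun z => tdelta M' (quo Lc z) t) (fun z m => ?_)
    (fun z => abs_tdelta_le M' (quo Lc z) t)
  refine tdelta_quo_congr M' Lc (fun i => ⟨m i, ?_⟩) t
  simp only [translate_apply, fine]
  push_cast
  ring

end TorusKernel

/-! ## §5 In the torus call's presentation: `H₀ * D₁ = 0`, `H₀ * D₂ = 0`, `a0`: `H₀ * fromCols D₂ D₁ = 0`, `H₀ᵀ = H₀`, `a0t` -/

section TorusCall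

variable (M' : Fin (d + 1) → ℕ) [∀ μ, NeZero (M' μ)] {Lc : ℕ} [NeZero Lc] {r r' : Fin (d + 1) → ℕ} (hr : r ∈ box (d + 1) Lc) (j : ℕ)
  -- the torus call's objects, by their defining equations (p313662 `hH₀ hD₁ hD₂` VERBATIM)
  {H₀ : Matrix (↥(pbox (fine Lc M')) × Fin (d + 1)) (↥(pbox (fine Lc M')) × Fin (d + 1)) ℝ}
  (hH₀ : H₀ = (perF (fine Lc M') (bhKStepAt d (toSite r) Lc j)).submatrix
      (fun b : ↥(pbox (fine Lc M')) × Fin (d + 1) => ((b.1, Sum.inl b.2) : Idx (fine Lc M') (Fib d)))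
      (fun b : ↥(pbox (fine Lc M')) × Fin (d + 1) => ((b.1, Sum.inl b.2) : Idx (fine Lc M') (Fib d))))
  {D₁ : Matrix (↥(pbox (fine Lc M')) × Fin (d + 1)) (Res (toSite r) Lc (fine Lc M')) ℝ}
  (hD₁ : D₁ = (tgrad (fine Lc M')).submatrix (fun b : ↥(pbox (fine Lc M')) × Fin (d + 1) => ((b.1, Sum.inl b.2) : Idx (fine Lc M') (Fib d)))
      (Subtype.val : Res (toSite r) Lc (fine Lc M') → ↥(pbox (fine Lc M'))))
  {D₂ : Matrix (↥(pbox (fine Lc M')) × Fin (d + 1)) (Res (toSite r') Lc M') ℝ}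
  (hD₂ : D₂ = (tgradBlock M' Lc).submatrix (fun b : ↥(pbox (fine Lc M')) × Fin (d + 1) => ((b.1, Sum.inl b.2) : Idx (fine Lc M') (Fib d)))
      (Subtype.val : Res (toSite r') Lc M' → ↥(pbox M')))

include hr hH₀ in
/-- [folklore] **`H₀` KILLS EVERY `tgrad` COLUMN** (any column selection `g`): with the torus call's `hH₀`, `H₀ * (tgrad (fine Lc M′))∘(fields, g) = 0`. -/
theorem torus_H₀_mul_tgrad {γ : Type*} (g : γ → ↥(pbox (fine Lc M'))) :
    H₀ * (tgrad (fine Lc M')).submatrix (fun b : ↥(pbox (fine Lc M')) × Fin (d + 1) => ((b.1, Sum.inl b.2) : Idx (fine Lc M') (Fib d))) g = 0 := by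
  ext p c
  rw [hH₀, Matrix.mul_apply, Fintype.sum_prod_type, Matrix.zero_apply]
  simp only [Matrix.submatrix_apply, perF_apply]
  exact sum_perZ_bhKStepAt_ff_mul_tgrad (fine Lc M') hr j (p.1 : Site (d + 1)) p.2 (g c)

include hr hH₀ in
/-- [folklore] **`H₀` KILLS EVERY `tgradBlock` COLUMN** (any column selection `g` of coarse box points): `H₀ * (tgradBlock M′ Lc)∘(fields, g) = 0`. -/
theorem torus_H₀_mul_tgradBlock {γ : Type*} (g : γ → ↥(pbox M')) :
    H₀ * (tgradBlock M' Lc).submatrix (fun b : ↥(pbox (fine Lc M')) × Fin (d + 1) => ((b.1, Sum.inl b.2) : Idx (fine Lc M') (Fib d))) g = 0 := by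
  ext p c
  rw [hH₀, Matrix.mul_apply, Fintype.sum_prod_type, Matrix.zero_apply]
  simp only [Matrix.submatrix_apply, perF_apply]
  exact sum_perZ_bhKStepAt_ff_mul_tgradBlock M' hr j (p.1 : Site (d + 1)) p.2 (g c)

include hr hH₀ hD₁ in
/-- [folklore] **`H₀ * D₁ = 0`** — the fine residual gauge modes of the torus call (`hD₁` verbatim). -/
theorem torus_H₀_mul_D₁ : H₀ * D₁ = 0 := by
  rw [hD₁]
  exact torus_H₀_mul_tgrad M' hr j hH₀ Subtype.val

include hr hH₀ hD₂ in
/-- [folklore] **`H₀ * D₂ = 0`** — the block-constant gauge modes of the torus call (`hD₂` verbatim). -/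
theorem torus_H₀_mul_D₂ : H₀ * D₂ = 0 := by
  rw [hD₂]
  exact torus_H₀_mul_tgradBlock M' hr j hH₀ Subtype.val

include hr hH₀ hD₁ hD₂ in
/-- [folklore] **ROW `a0` OF THE TORUS CALL WITH `Y₀ := 0`**: `H₀ * fromCols D₂ D₁ = 0` (`= 𝔔₀ᵀ * 0`) — every `j`, every pair of in-block roots `r r′`, every `M′`. -/
theorem torus_a0 : H₀ * Matrix.fromCols D₂ D₁ = 0 := by
  rw [Matrix.mul_fromCols, torus_H₀_mul_D₂ M' hr j hH₀ hD₂, torus_H₀_mul_D₁ M' hr j hH₀ hD₁, Matrix.fromCols_zero]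

omit [∀ μ, NeZero (M' μ)] in
include hH₀ in
/-- [folklore] **`H₀` IS SYMMETRIC**: `H₀ᵀ = H₀` (the step candidate is invariant under the period lattice — `RelInvPeriodised.bhKStepAt_translate_invariant`,
`Lc ∣ fine Lc M′` — so `(perF K)ᵀ = perF (trF K)` (`perF_transpose`), and the field block of `trF K` is that of `K` by `bhKStepAt_ff_symm`). -/
theorem torus_H₀_transpose : H₀ᵀ = H₀ := by
  have hM : ∀ i, Lc ∣ fine Lc M' i := fun i => ⟨M' i, rfl⟩
  rw [hH₀, Matrix.transpose_submatrix, ← perF_transpose (fine Lc M') (bhKStepAt_translate_invariant (toSite r) Lc j (fine Lc M') hM)]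
  ext p q
  simp only [Matrix.submatrix_apply, perF_apply, perZ_apply, trF]
  exact tsum_congr fun m => (bhKStepAt_ff_symm (toSite r) j _ _ _ _).symm

include hr hH₀ hD₁ hD₂ in
/-- [folklore] **ROW `a0t` OF THE TORUS CALL WITH `Y'₀ := 0`**: `H₀ᵀ * fromCols D₂ D₁ = 0`. -/
theorem torus_a0t : H₀ᵀ * Matrix.fromCols D₂ D₁ = 0 := by
  rw [torus_H₀_transpose M' j hH₀]
  exact torus_a0 M' hr j hH₀ hD₁ hD₂

include hr hH₀ hD₁ hD₂ in
/-- [folklore] **`a0` IN THE CALL's LETTER SHAPE** (`Y₀ := 0`): `H₀ * fromCols D₂ D₁ = 𝔔₀ᵀ * 0` for ANY composite averaging `𝔔₀` on any coarse multiplier index `κ`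
— pass `Y₀ := 0` and this term as the binder `a0` of `NestedStepLawTorusInstance(Delta).secondVar_oneShot_nestedStepLaw_torus(_delta)`. -/
theorem torus_a0_letter {κ : Type*} [Fintype κ] (𝔔₀ : Matrix κ (↥(pbox (fine Lc M')) × Fin (d + 1)) ℝ) :
    H₀ * Matrix.fromCols D₂ D₁ = 𝔔₀ᵀ * (0 : Matrix κ (Res (toSite r') Lc M' ⊕ Res (toSite r) Lc (fine Lc M')) ℝ) := by
  rw [Matrix.mul_zero]
  exact torus_a0 M' hr j hH₀ hD₁ hD₂

include hr hH₀ hD₁ hD₂ in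
/-- [folklore] **`a0t` IN THE CALL's LETTER SHAPE** (`Y'₀ := 0`): `H₀ᵀ * fromCols D₂ D₁ = 𝔔₀ᵀ * 0`. -/
theorem torus_a0t_letter {κ : Type*} [Fintype κ] (𝔔₀ : Matrix κ (↥(pbox (fine Lc M')) × Fin (d + 1)) ℝ) :
    H₀ᵀ * Matrix.fromCols D₂ D₁ = 𝔔₀ᵀ * (0 : Matrix κ (Res (toSite r') Lc M' ⊕ Res (toSite r) Lc (fine Lc M')) ℝ) := by
  rw [Matrix.mul_zero]
  exact torus_a0t M' hr j hH₀ hD₁ hD₂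

end TorusCall

end Summit.QuantumFields.BalabanUV.Beta.FP.PeriodisedWardOrderZero

end
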